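import Summits.HodgeConjecture.HodgeConjecture.Theorems.TropicalKugaSatakeCayleyEffectiveCayleyNonRealizabilityCycleClassHodge
import Summits.HodgeConjecture.HodgeConjecture.Theorems.TropicalKugaSatakeCayleyEffectiveCayleyNonRealizabilityIdentityPrinciple
import HarnessLib

/-!
# The period class of a formal chain of the Kuga–Satake family lies in the COMMON kernel of the
# family's eigenwaves — crux `EffectiveCayleyNonRealizability` (stmt-HodgeConjecture-18569)

Route `TropicalKugaSatakeCayley` of `HodgeConjecture`, line `formal_rational`. Let `𝒵` be a formal
framed `2`-chain over `ℚ[t₀,…,t₄]` whose evaluations have the constant rational period class `Mq` on a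
non-empty open `V ⊆ ksPosCone` (the hypothesis format of the remaining stub
`stub_formalCoreRigidity` and of the rung `stub_rung_sixthDirection`). Then
(`eigenwave_compound_ksMatrix_mul_eq_zero`)

  `eigenwave (compound 2 (ksMatrix t) · Mq) = 0` for EVERY `t ∈ ℝ⁵`,

i.e. `Mq` lies in the birth line's class space `K = {M | ∀ t, eigenwave (compound 2 (B_t) M) = 0}`
(`Mq ∈ hodgeClasses (ksMatrix t) 1` for all `t`, `mem_hodgeClasses_ksMatrix`). Proof: at ONE
`t₀ ∈ V` with algebraically independent coordinates, `classOf (𝒵(t₀)) = compound 2 (B_{t₀}) · Mq`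
(Cauchy–Binet, `compound_two_mul_nonsing_inv`) is killed by the eigenwave (Mikhalkin–Zharkov
Thm. 5.4 for chains, `eigenwave_classOf`); this is the evaluation at `t₀` of the POLYNOMIAL matrix
`eigenwave (compound 2 (Σ tᵢ ksForm i) · Mq)` over `ℚ[t]` (`eigenwave_map`, `compound_map`), so that
matrix vanishes identically (`aeval t₀` is injective), hence at every `t`. So "eigenwave kills
formal cycle classes in every direction of the family" — the first step of the rung (whose remaining
content is the kernel computation `dim = 1` over `F₊`) and of any attack on the bet (`dim = 6` over
`F_KS`: theta ⊕ Cayley). The cycle condition is not even needed: the vanishing is cell by cell.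

No named fact, no new definition, no sorry.
References: [MikhalkinZharkov2014Eigenwave] G. Mikhalkin, I. Zharkov, Tropical eigenwave and
intermediate Jacobians, LN UMI 15 (2014), Thm. 5.4; [Zharkov2020TropicalWeil] I. Zharkov,
arXiv:2002.02347, pp. 2–3.
-/

noncomputable section

-- `Summit.HodgeConjecture.HodgeConjecture.…` is the mandated namespace (single-conjunct summit).
set_option linter.dupNamespace false

open scoped BigOperators Matrix

namespace Summit.HodgeConjecture.HodgeConjecture.Theorems.EffectiveCayleyNonRealizability

open Literature.AlgebraicGeometry.Tropical
open Literature.AlgebraicGeometry.Tropical.TropicalTorus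

/-! ### Compounds and eigenwaves commute with ring maps -/

section Maps

variable {R S : Type*} [CommRing R] [CommRing S] {g : ℕ}

/-- Minors commute with ring maps. [folklore] -/
theorem minor_map (f : R →+* S) (A : Matrix (Fin g) (Fin g) R) {p : ℕ} (I J : Sub g p) :
    minor (A.map f) I J = f (minor A I J) := by
  unfold minor
  rw [RingHom.map_det, Matrix.submatrix_map]
  rfl

/-- Compound matrices commute with ring maps. [folklore] -/
theorem compound_map (f : R →+* S) (p : ℕ) (A : Matrix (Fin g) (Fin g) R) :
    compound p (A.map f) = (compound p A).map f := by
  ext I J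
  simp only [compound, Matrix.of_apply, Matrix.map_apply, minor_map]

/-- The eigenwave commutes with ring maps (its entries are signed sums of entries). [folklore] -/
theorem eigenwave_map (f : R →+* S) {q : ℕ} (C : Matrix (Sub g (q + 1)) (Sub g (q + 1)) R) :
    eigenwave (C.map f) = (eigenwave C).map f := by
  classical
  ext K J
  simp only [eigenwave, Matrix.of_apply, Matrix.map_apply, map_sum]
  refine Finset.sum_congr rfl fun k _ => ?_
  split_ifs
  · simp
  · simp

end Maps

/-! ### The class of a formal chain is in the common kernel -/

/-- **Eigenwaves of the whole family kill the period class of a formal chain.** If a formal framed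
`2`-chain `𝒵` over `ℚ[t₀,…,t₄]` has evaluations with constant rational period class `Mq` on a
non-empty open `V ⊆ ksPosCone`, then `eigenwave (compound 2 (ksMatrix t) · Mq) = 0` for EVERY
`t ∈ ℝ⁵`. [cite: MikhalkinZharkov2014Eigenwave, Thm. 5.4] [cite: Zharkov2020TropicalWeil, p. 3] -/
theorem eigenwave_compound_ksMatrix_mul_eq_zero (𝒵 : Chain (MvPolynomial (Fin 5) ℚ) 8 2)
    (V : Set (Fin 5 → ℝ)) (hVo : IsOpen V) (hVne : V.Nonempty) (hVcone : V ⊆ ksPosCone)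
    (Mq : Matrix (Sub 8 2) (Sub 8 2) ℚ)
    (hV : ∀ t ∈ V, compound 2 (ksMatrix t)⁻¹ *
      (⟨𝒵.size, fun c => ⟨fun r => MvPolynomial.aeval t ((𝒵.cell c).base r), (𝒵.cell c).dir,
          fun i j => MvPolynomial.aeval t ((𝒵.cell c).coef i j), (𝒵.cell c).weight⟩⟩ :
          Chain ℝ 8 2).classOf = Mq.map (algebraMap ℚ ℝ)) (t : Fin 5 → ℝ) :
    eigenwave (q := 1) (compound 2 (ksMatrix t) * Mq.map (algebraMap ℚ ℝ)) = 0 := by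
  -- the polynomial matrix `F = eigenwave (compound 2 (Σ tᵢ ksForm i) · Mq)` over `ℚ[t]`
  set P : Matrix (Fin 8) (Fin 8) (MvPolynomial (Fin 5) ℚ) :=
    ∑ i : Fin 5, (MvPolynomial.X i : MvPolynomial (Fin 5) ℚ) •
      (ksForm i).map (Int.cast : ℤ → MvPolynomial (Fin 5) ℚ) with hP
  set F : Matrix (Sub 8 1) (Sub 8 (1 + 2)) (MvPolynomial (Fin 5) ℚ) :=
    eigenwave (q := 1) (compound 2 P * Mq.map (algebraMap ℚ (MvPolynomial (Fin 5) ℚ))) with hF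
  -- its evaluation at any parameter `s` is the target at `s`
  have hFeval : ∀ s : Fin 5 → ℝ, F.map (MvPolynomial.aeval s) =
      eigenwave (q := 1) (compound 2 (ksMatrix s) * Mq.map (algebraMap ℚ ℝ)) := by
    intro s
    let φ : MvPolynomial (Fin 5) ℚ →+* ℝ := (MvPolynomial.aeval s).toRingHom
    have e1 : F.map (MvPolynomial.aeval s) = F.map φ := rfl
    have e2 : P.map φ = ksMatrix s := ksMatrixPoly_map_aeval s
    have e3 : (Mq.map (algebraMap ℚ (MvPolynomial (Fin 5) ℚ))).map φ = Mq.map (algebraMap ℚ ℝ) := by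
      ext i j
      simp only [Matrix.map_apply, φ, AlgHom.toRingHom_eq_coe, RingHom.coe_coe, AlgHom.commutes]
    rw [e1, hF, ← eigenwave_map φ, Matrix.map_mul, ← compound_map φ, e2, e3]
  -- at a generic `t₀ ∈ V` the target vanishes: the class of the evaluated chain is killed
  obtain ⟨t₀, ht₀V, ht₀⟩ := exists_algebraicIndependent_mem hVo hVne
  have hdet : IsUnit (ksMatrix t₀).det := isUnit_iff_ne_zero.2 (hVcone ht₀V).det_pos.ne'
  have hzero : eigenwave (q := 1) (compound 2 (ksMatrix t₀) * Mq.map (algebraMap ℚ ℝ)) = 0 := by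
    rw [← hV t₀ ht₀V, ← Matrix.mul_assoc, compound_two_mul_nonsing_inv _ hdet, Matrix.one_mul]
    exact eigenwave_classOf _
  -- hence `F = 0` (injectivity of `aeval t₀`), hence the target vanishes at every `t`
  have hF0 : F = 0 := by
    refine Matrix.ext fun K J => ?_
    have h := congr_fun (congr_fun (hFeval t₀) K) J
    rw [hzero, Matrix.map_apply, Matrix.zero_apply] at h
    rw [Matrix.zero_apply]
    apply injective_aeval_of_algebraicIndependent ht₀
    rw [map_zero]
    exact h
  rw [← hFeval t, hF0]
  ext K J
  simp

/-- **The period class of a formal chain is a tropical Hodge class of EVERY member of the family**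
(`Mq ∈ hodgeClasses (ksMatrix t) 1` for all `t ∈ ℝ⁵`): it lies in the birth line's class space
`K = {M | ∀ t, eigenwave (compound 2 (ksMatrix t) · M) = 0}` of crux stmt-HodgeConjecture-18569.
[cite: MikhalkinZharkov2014Eigenwave, Thm. 5.4] [cite: Zharkov2020TropicalWeil, p. 3] -/
theorem mem_hodgeClasses_ksMatrix (𝒵 : Chain (MvPolynomial (Fin 5) ℚ) 8 2)
    (V : Set (Fin 5 → ℝ)) (hVo : IsOpen V) (hVne : V.Nonempty) (hVcone : V ⊆ ksPosCone)
    (Mq : Matrix (Sub 8 2) (Sub 8 2) ℚ)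
    (hV : ∀ t ∈ V, compound 2 (ksMatrix t)⁻¹ *
      (⟨𝒵.size, fun c => ⟨fun r => MvPolynomial.aeval t ((𝒵.cell c).base r), (𝒵.cell c).dir,
          fun i j => MvPolynomial.aeval t ((𝒵.cell c).coef i j), (𝒵.cell c).weight⟩⟩ :
          Chain ℝ 8 2).classOf = Mq.map (algebraMap ℚ ℝ)) (t : Fin 5 → ℝ) :
    Mq ∈ hodgeClasses (ksMatrix t) 1 :=
  eigenwave_compound_ksMatrix_mul_eq_zero 𝒵 V hVo hVne hVcone Mq hV t

end Summit.HodgeConjecture.HodgeConjecture.Theorems.EffectiveCayleyNonRealizability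

end
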